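import Summits.CriticalPhenomena.PercolationContinuityZ3.Theorems.PercNearOneGluingNoHeavyQuantThreeClusterCountReduction
import HarnessLib

/-!
# Per-class counting: `TN ≤ 2·E + #R₀` on every minor, and `#R₀ ≤ E on every minor ⟹ F1 ≤ 3`

builds on p205010 (kernel theorem, internal audit signed; external expert review pending)

Support file (`--supports stmt-CriticalPhenomena-4575`), seat `prim-quant-p1` (gen 42); memo
`run/shared/lean/prim/quant/prim-quant-p1-g42/FOR-LEAD-Z32-CUTOFF.md` §2.  No definitions, no named facts, no sorries; standard axioms.

Assembly of the counting injections of the companion file (`classCount_seal_le`, `classCount_cut_le`):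
* `card_filter_le_of_cover` — bookkeeping: a predicate covered by four predicates with known counts plus a fifth;
* `classCount_TN_le_two_E_add_R0` — in every class `I ⊆ U`: `TN ≤ 2·E + #R₀` (`TN` = `{T : I ∪ T ∈ abc, I ∪ (F∖T) ∈ a|b|c}`,
  `E` = `{T : I ∪ T ∈ ab|c ∪ ac|b}`, `R₀` = `TN ∩ {both seals and both cut-offs fail}`), the counting twin of ✓ p611369;
* `productRow_three_of_classCount_R0` — if `#R₀ ≤ E` in every class then `P(abc)·P(a|b|c) ≤ 3·(P(ab|c) + P(ac|b))` on every
  finite weighted graph (✓ p583525 `productRow_of_classCount`, `m = 3`), the per-apex hypothesis shape of ✓ p560550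
  `ThreePort.le_one_reached_le_of_productRow3` (three-port `Z(3,2)`).
So the coefficientwise obligation for the three-port case is now literally `#R₀ ≤ E` per class.  Census (memo §3, exact
enumeration): `R₀ = ∅` on every graph with ≤ 5 vertices and every multigraph tested; 8 of 119 314 `TN`-configurations on
6 vertices; 1 572 of 13.2 M on 7; the maximum-split rule of the memo covers all of these (first escape at 8 vertices).
-/

namespace Summit.CriticalPhenomena.PercolationContinuityZ3.Theorems

open Finset Literature.Probability.Percolation Literature.Probability.Percolation.DecisionTree

variable {V : Type*}

namespace ThreeClusterSwap

open scoped Classical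

/-- Bookkeeping: if `p ⊆ p₁ ∪ p₂ ∪ p₃ ∪ p₄ ∪ p₅` on `s`, `#p₁, #p₄ ≤ #q_b`, `#p₂, #p₃ ≤ #q_a`, and `q_a, q_b` are disjoint,
then `#p ≤ 2·#(q_a ∨ q_b) + #p₅`.  (Decidability instances are taken as implicit arguments so that the lemma unifies with
whatever instances the filters carry.) [this work] -/
theorem card_filter_le_of_cover {β : Type*} {s : Finset β} {p p₁ p₂ p₃ p₄ p₅ qa qb : β → Prop}
    {d : DecidablePred p} {d₁ : DecidablePred p₁} {d₂ : DecidablePred p₂} {d₃ : DecidablePred p₃}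
    {d₄ : DecidablePred p₄} {d₅ : DecidablePred p₅} {da : DecidablePred qa} {db : DecidablePred qb}
    {dab : DecidablePred fun x => qa x ∨ qb x}
    (h₁ : (@Finset.filter β p₁ d₁ s).card ≤ (@Finset.filter β qb db s).card)
    (h₂ : (@Finset.filter β p₂ d₂ s).card ≤ (@Finset.filter β qa da s).card)
    (h₃ : (@Finset.filter β p₃ d₃ s).card ≤ (@Finset.filter β qa da s).card)
    (h₄ : (@Finset.filter β p₄ d₄ s).card ≤ (@Finset.filter β qb db s).card)
    (hdisj : ∀ x, qa x → qb x → False)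
    (hcover : ∀ x ∈ s, p x → p₁ x ∨ p₂ x ∨ p₃ x ∨ p₄ x ∨ p₅ x) :
    (@Finset.filter β p d s).card ≤
      2 * (@Finset.filter β (fun x => qa x ∨ qb x) dab s).card + (@Finset.filter β p₅ d₅ s).card := by
  have hcov : @Finset.filter β p d s ⊆
      (((@Finset.filter β p₁ d₁ s ∪ @Finset.filter β p₂ d₂ s) ∪ (@Finset.filter β p₃ d₃ s ∪ @Finset.filter β p₄ d₄ s)) ∪
        @Finset.filter β p₅ d₅ s) := by
    intro x hx
    rw [Finset.mem_filter] at hx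
    simp only [Finset.mem_union, Finset.mem_filter]
    rcases hcover x hx.1 hx.2 with h | h | h | h | h
    · exact Or.inl (Or.inl (Or.inl ⟨hx.1, h⟩))
    · exact Or.inl (Or.inl (Or.inr ⟨hx.1, h⟩))
    · exact Or.inl (Or.inr (Or.inl ⟨hx.1, h⟩))
    · exact Or.inl (Or.inr (Or.inr ⟨hx.1, h⟩))
    · exact Or.inr ⟨hx.1, h⟩
  have hE : (@Finset.filter β qa da s).card + (@Finset.filter β qb db s).card ≤
      (@Finset.filter β (fun x => qa x ∨ qb x) dab s).card := by
    rw [← Finset.card_union_of_disjoint]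
    · refine Finset.card_le_card fun x hx => ?_
      rw [Finset.mem_union, Finset.mem_filter, Finset.mem_filter] at hx
      rw [Finset.mem_filter]
      rcases hx with ⟨h1, h2⟩ | ⟨h1, h2⟩
      · exact ⟨h1, Or.inl h2⟩
      · exact ⟨h1, Or.inr h2⟩
    · rw [Finset.disjoint_left]
      intro x h1 h2
      rw [Finset.mem_filter] at h1 h2
      exact hdisj x h1.2 h2.2
  have h0 := (Finset.card_le_card hcov).trans (Finset.card_union_le _ _)
  have h5 := Finset.card_union_le (@Finset.filter β p₁ d₁ s ∪ @Finset.filter β p₂ d₂ s)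
    (@Finset.filter β p₃ d₃ s ∪ @Finset.filter β p₄ d₄ s)
  have h6 := Finset.card_union_le (@Finset.filter β p₁ d₁ s) (@Finset.filter β p₂ d₂ s)
  have h7 := Finset.card_union_le (@Finset.filter β p₃ d₃ s) (@Finset.filter β p₄ d₄ s)
  omega

section Count

variable [Fintype V] [DecidableEq V]

/-- **Per-class counting: `TN ≤ 2·E + #R₀`.**  In every class `I ⊆ U` (free edges `U ∖ I`; `C₁ = I ∪ T ∈ abc`,
`C₂ = I ∪ ((U ∖ I) ∖ T) ∈ a|b|c`): the number of such `T` is at most twice the number of `T` with `I ∪ T ∈ ab|c ∪ ac|b`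
plus the number of `T` in the residual `R₀` (both seals and both cut-offs fail) — the counting twin of ✓ p611369
`productRow_le_two_add_Pr2W`: `TN ⊆ (σ_b ok) ∪ (σ_c ok) ∪ (κ_c ok, σ_b fails) ∪ (κ_b ok, σ_c fails) ∪ R₀` and
`classCount_seal_le`, `classCount_cut_le` twice each. [this work] -/
theorem classCount_TN_le_two_E_add_R0 (a b c : V) (I U : Finset (Sym2 V)) :
    (((U \ I).powerset).filter fun T =>
          (¬ (openGraph (↑(I ∪ ((U \ I) \ T)) : Set (Sym2 V))).Reachable a b ∧
            ¬ (openGraph (↑(I ∪ ((U \ I) \ T)) : Set (Sym2 V))).Reachable a c ∧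
            ¬ (openGraph (↑(I ∪ ((U \ I) \ T)) : Set (Sym2 V))).Reachable b c) ∧
          ((openGraph (↑(I ∪ T) : Set (Sym2 V))).Reachable a b ∧
            (openGraph (↑(I ∪ T) : Set (Sym2 V))).Reachable a c)).card ≤
    2 * (((U \ I).powerset).filter fun T =>
          ((openGraph (↑(I ∪ T) : Set (Sym2 V))).Reachable a b ∧
              ¬ (openGraph (↑(I ∪ T) : Set (Sym2 V))).Reachable a c) ∨
            ((openGraph (↑(I ∪ T) : Set (Sym2 V))).Reachable a c ∧
              ¬ (openGraph (↑(I ∪ T) : Set (Sym2 V))).Reachable a b)).card +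
    (((U \ I).powerset).filter fun T =>
          (¬ (openGraph (↑(I ∪ ((U \ I) \ T)) : Set (Sym2 V))).Reachable a b ∧
            ¬ (openGraph (↑(I ∪ ((U \ I) \ T)) : Set (Sym2 V))).Reachable a c ∧
            ¬ (openGraph (↑(I ∪ ((U \ I) \ T)) : Set (Sym2 V))).Reachable b c) ∧
          ((openGraph (↑(I ∪ T) : Set (Sym2 V))).Reachable a b ∧
            (openGraph (↑(I ∪ T) : Set (Sym2 V))).Reachable a c) ∧
        ¬ (openGraph ((↑(I ∪ T) : Set (Sym2 V)) \
            {e | ∃ v ∈ {v | (openGraph (↑(I ∪ ((U \ I) \ T)) : Set (Sym2 V))).Reachable c v}, v ∈ e})).Reachable a b ∧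
        ¬ (openGraph ((↑(I ∪ T) : Set (Sym2 V)) \
            {e | ∃ v ∈ {v | (openGraph (↑(I ∪ ((U \ I) \ T)) : Set (Sym2 V))).Reachable b v}, v ∈ e})).Reachable a c ∧
        ¬ (openGraph ((↑(I ∪ T) : Set (Sym2 V)) \
            {e | ∃ q ∈ {q | (openGraph ((↑(I ∪ T) : Set (Sym2 V)) \
                  {e | ∃ v ∈ {v | (openGraph (↑(I ∪ ((U \ I) \ T)) : Set (Sym2 V))).Reachable b v}, v ∈ e})).Reachable c q},
                 ∃ s ∈ {v | (openGraph (↑(I ∪ ((U \ I) \ T)) : Set (Sym2 V))).Reachable b v}, e = s(q, s)})).Reachable a b ∧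
        ¬ (openGraph ((↑(I ∪ T) : Set (Sym2 V)) \
            {e | ∃ q ∈ {q | (openGraph ((↑(I ∪ T) : Set (Sym2 V)) \
                  {e | ∃ v ∈ {v | (openGraph (↑(I ∪ ((U \ I) \ T)) : Set (Sym2 V))).Reachable c v}, v ∈ e})).Reachable b q},
                 ∃ s ∈ {v | (openGraph (↑(I ∪ ((U \ I) \ T)) : Set (Sym2 V))).Reachable c v}, e = s(q, s)})).Reachable a c).card := by
  refine card_filter_le_of_cover (classCount_seal_le I (U \ I) a c b) (classCount_seal_le I (U \ I) a b c)
    (classCount_cut_le I (U \ I) a b c) (classCount_cut_le I (U \ I) a c b) (fun T h1 h2 => h1.2 h2.1)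
    fun T _ hp => ?_
  obtain ⟨⟨hnab, hnac, hnbc⟩, habc⟩ := hp
  by_cases h1 : (openGraph ((↑(I ∪ T) : Set (Sym2 V)) \
            {e | ∃ v ∈ {v | (openGraph (↑(I ∪ ((U \ I) \ T)) : Set (Sym2 V))).Reachable b v}, v ∈ e})).Reachable a c
  · exact Or.inl ⟨hnab, h1⟩
  by_cases h2 : (openGraph ((↑(I ∪ T) : Set (Sym2 V)) \
            {e | ∃ v ∈ {v | (openGraph (↑(I ∪ ((U \ I) \ T)) : Set (Sym2 V))).Reachable c v}, v ∈ e})).Reachable a b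
  · exact Or.inr (Or.inl ⟨hnac, h2⟩)
  by_cases h3 : (openGraph ((↑(I ∪ T) : Set (Sym2 V)) \
            {e | ∃ q ∈ {q | (openGraph ((↑(I ∪ T) : Set (Sym2 V)) \
                  {e | ∃ v ∈ {v | (openGraph (↑(I ∪ ((U \ I) \ T)) : Set (Sym2 V))).Reachable b v}, v ∈ e})).Reachable c q},
                 ∃ s ∈ {v | (openGraph (↑(I ∪ ((U \ I) \ T)) : Set (Sym2 V))).Reachable b v}, e = s(q, s)})).Reachable a b
  · exact Or.inr (Or.inr (Or.inl ⟨hnbc, h1, h3⟩))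
  by_cases h4 : (openGraph ((↑(I ∪ T) : Set (Sym2 V)) \
            {e | ∃ q ∈ {q | (openGraph ((↑(I ∪ T) : Set (Sym2 V)) \
                  {e | ∃ v ∈ {v | (openGraph (↑(I ∪ ((U \ I) \ T)) : Set (Sym2 V))).Reachable c v}, v ∈ e})).Reachable b q},
                 ∃ s ∈ {v | (openGraph (↑(I ∪ ((U \ I) \ T)) : Set (Sym2 V))).Reachable c v}, e = s(q, s)})).Reachable a c
  · exact Or.inr (Or.inr (Or.inr (Or.inl ⟨fun h => hnbc h.symm, h2, h4⟩)))
  · exact Or.inr (Or.inr (Or.inr (Or.inr ⟨⟨hnab, hnac, hnbc⟩, habc, h2, h1, h3, h4⟩)))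

/-- **The product row with constant `3` from the residual count.**  If in every class `I ⊆ U` the residual `R₀` (both seals
and both cut-offs fail) has at most as many configurations as `ab|c ∪ ac|b`, then
`P(a↔b ∧ a↔c)·P(a↮b ∧ a↮c ∧ b↮c) ≤ 3·(P(a↔b ∧ a↮c) + P(a↔c ∧ a↮b))` on every finite weighted graph
(`classCount_TN_le_two_E_add_R0` and ✓ p583525 `productRow_of_classCount` with `m = 3`) — the per-apex hypothesis shape
of ✓ p560550 `ThreePort.le_one_reached_le_of_productRow3` (three-port `Z(3,2)`), up to the off-observer restriction
handled there.  Census (memo §3): `R₀ = ∅` on every graph with ≤ 5 vertices and every multigraph tested. [this work] -/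
theorem productRow_three_of_classCount_R0 (w : Sym2 V → unitInterval) (a b c : V)
    (hR0 : ∀ I U : Finset (Sym2 V), I ⊆ U →
      (((U \ I).powerset).filter fun T =>
          (¬ (openGraph (↑(I ∪ ((U \ I) \ T)) : Set (Sym2 V))).Reachable a b ∧
            ¬ (openGraph (↑(I ∪ ((U \ I) \ T)) : Set (Sym2 V))).Reachable a c ∧
            ¬ (openGraph (↑(I ∪ ((U \ I) \ T)) : Set (Sym2 V))).Reachable b c) ∧
          ((openGraph (↑(I ∪ T) : Set (Sym2 V))).Reachable a b ∧
            (openGraph (↑(I ∪ T) : Set (Sym2 V))).Reachable a c) ∧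
        ¬ (openGraph ((↑(I ∪ T) : Set (Sym2 V)) \
            {e | ∃ v ∈ {v | (openGraph (↑(I ∪ ((U \ I) \ T)) : Set (Sym2 V))).Reachable c v}, v ∈ e})).Reachable a b ∧
        ¬ (openGraph ((↑(I ∪ T) : Set (Sym2 V)) \
            {e | ∃ v ∈ {v | (openGraph (↑(I ∪ ((U \ I) \ T)) : Set (Sym2 V))).Reachable b v}, v ∈ e})).Reachable a c ∧
        ¬ (openGraph ((↑(I ∪ T) : Set (Sym2 V)) \
            {e | ∃ q ∈ {q | (openGraph ((↑(I ∪ T) : Set (Sym2 V)) \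
                  {e | ∃ v ∈ {v | (openGraph (↑(I ∪ ((U \ I) \ T)) : Set (Sym2 V))).Reachable b v}, v ∈ e})).Reachable c q},
                 ∃ s ∈ {v | (openGraph (↑(I ∪ ((U \ I) \ T)) : Set (Sym2 V))).Reachable b v}, e = s(q, s)})).Reachable a b ∧
        ¬ (openGraph ((↑(I ∪ T) : Set (Sym2 V)) \
            {e | ∃ q ∈ {q | (openGraph ((↑(I ∪ T) : Set (Sym2 V)) \
                  {e | ∃ v ∈ {v | (openGraph (↑(I ∪ ((U \ I) \ T)) : Set (Sym2 V))).Reachable c v}, v ∈ e})).Reachable b q},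
                 ∃ s ∈ {v | (openGraph (↑(I ∪ ((U \ I) \ T)) : Set (Sym2 V))).Reachable c v}, e = s(q, s)})).Reachable a c).card ≤
      (((U \ I).powerset).filter fun T =>
          ((openGraph (↑(I ∪ T) : Set (Sym2 V))).Reachable a b ∧
              ¬ (openGraph (↑(I ∪ T) : Set (Sym2 V))).Reachable a c) ∨
            ((openGraph (↑(I ∪ T) : Set (Sym2 V))).Reachable a c ∧
              ¬ (openGraph (↑(I ∪ T) : Set (Sym2 V))).Reachable a b)).card) :
    (Literature.Probability.LatticeModels.prodBernoulli w).real (openConn a b ∩ openConn a c) *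
      (Literature.Probability.LatticeModels.prodBernoulli w).real ((openConn a b)ᶜ ∩ (openConn a c)ᶜ ∩ (openConn b c)ᶜ) ≤
    3 * ((Literature.Probability.LatticeModels.prodBernoulli w).real (openConn a b ∩ (openConn a c)ᶜ) +
      (Literature.Probability.LatticeModels.prodBernoulli w).real (openConn a c ∩ (openConn a b)ᶜ)) := by
  refine productRow_of_classCount w a b c (m := 3) (by norm_num) fun I U hIU => ?_
  have h1 := classCount_TN_le_two_E_add_R0 a b c I U
  have h2 := hR0 I U hIU
  have h3 : (((U \ I).powerset).filter fun T =>
          (¬ (openGraph (↑(I ∪ ((U \ I) \ T)) : Set (Sym2 V))).Reachable a b ∧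
            ¬ (openGraph (↑(I ∪ ((U \ I) \ T)) : Set (Sym2 V))).Reachable a c ∧
            ¬ (openGraph (↑(I ∪ ((U \ I) \ T)) : Set (Sym2 V))).Reachable b c) ∧
          ((openGraph (↑(I ∪ T) : Set (Sym2 V))).Reachable a b ∧
            (openGraph (↑(I ∪ T) : Set (Sym2 V))).Reachable a c)).card ≤
      3 * (((U \ I).powerset).filter fun T =>
          ((openGraph (↑(I ∪ T) : Set (Sym2 V))).Reachable a b ∧
              ¬ (openGraph (↑(I ∪ T) : Set (Sym2 V))).Reachable a c) ∨
            ((openGraph (↑(I ∪ T) : Set (Sym2 V))).Reachable a c ∧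
              ¬ (openGraph (↑(I ∪ T) : Set (Sym2 V))).Reachable a b)).card := by omega
  exact_mod_cast h3

end Count

end ThreeClusterSwap

end Summit.CriticalPhenomena.PercolationContinuityZ3.Theorems
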